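import Mathlib
import Literature.Geometry.DiscreteGeometry.TwoShellPatterns
import Summits.AtomisticToContinuum.Crystallization.Theorems.PalmUnimodularRigidityShellsToBarlowChartCharts
import Summits.AtomisticToContinuum.Crystallization.Theorems.PalmUnimodularRigidityShellsToBarlowChartLocalCharts
import Summits.AtomisticToContinuum.Crystallization.Theorems.PalmUnimodularRigidityShellsToBarlowChartCubicGrowthAngle
import Summits.AtomisticToContinuum.Crystallization.Theorems.ChartedPlanarOrderStackedLayerGeometry

/-!
# Barlow gluing at tolerance `1/16` — part II: integer charts of a two-shell-good set

Route `OverbindingBudget` (stmt-AtomisticToContinuum-31280), cell `decomp-a2c`, lens 3.  The piece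
`OverbindingBudgetTwoShellShape.BarlowGluingW` asks: a uniformly discrete `Y ∋ 0` all of whose points are
`(1/16, 9/10, 103/100)`-two-shell-good (`IsTwoShellGoodSet`) has its `(0, 28/25]`-bond graph isomorphic to
the contact graph of a Barlow stacking (`IsCharted (μS Y)`).

This file supplies the LOCAL half, in exactly the currency consumed by the tree's proved development of
the crux `ShellsToBarlowChart` (`CleanHull.transfer_of_close`, `Clean.transportSystem_of_connected`,
`PalmGoodLaw.FunnelChart.barlowChart_of_transportSystem`):

* `twoShell_labels` — the kissing part of either two-shell pattern is `L/√18` with `L ∈ {fcc3Int, hcpInt}`,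
  the other six points have norm `√2`, distinct kissing points are at distance `1` or `≥ √2`, and the
  kissing points cover every direction with cosine `≥ 1/√2`;
* `intChart` — at every `x ∈ Y`: an integer chart (`L`, `nb`) labelling the bonded neighbours
  bijectively, each within `b/5` of its ideal position at the COMMON scale `b = 193/200`
  (`a/16 + |a − b| ≤ b/5` for `a ∈ [9/10, 103/100]`), with exact links (bonds among neighbours = label
  pairs at squared distance `18`; the direction `⇐` uses the NEIGHBOUR's own pattern:
  `17/16·103/100 < 28/25 < (√2 − 1/16)·9/10`), and a bonded neighbour in every direction
  (cosine `≥ 139/250`).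

Part III (`…ChartedPlanarOrderBarlowGluing`) adds the transfer identity along bonds, connectivity and cubic growth.

No new idea: tolerance `1/16` with per-site scales is admissible because the development's interfaces are
combinatorial (label transfer at matching radius `b/5`), not metric.
-/

noncomputable section

namespace Summit.AtomisticToContinuum.Crystallization.Theorems.ChartedPlanarOrderBarlowGluingCharts

open Literature.Geometry.DiscreteGeometry
open Summit.AtomisticToContinuum.Crystallization.Theorems.PalmUnimodularRigidityShellsToBarlowChart
open Summit.AtomisticToContinuum.Crystallization.Theorems.ChartedPlanarOrderStackedLayerGeometry (sqrt_two_bounds)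
open Metric

local notation "E3" => EuclideanSpace ℝ (Fin 3)

/-! ## §1 Numerics (`sqrt_two_bounds : 1.4142 < √2 < 1.4143` is imported from `…ChartedPlanarOrderStackedLayerGeometry`) -/

/-! ## §2 The kissing part of a two-shell pattern as integer labels -/

/-- Membership in a pattern scaled by `1/√18`. [folklore] -/
theorem mem_scaledPattern_eighteen {L : Finset (Fin 3 → ℤ)} {v : E3} :
    v ∈ scaledPattern L 18 ↔ ∃ t ∈ L, ((Real.sqrt 18)⁻¹ • intVec t : E3) = v := by
  rw [scaledPattern, Finset.mem_image]
  simp only [Nat.cast_ofNat]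

/-- Distance of two scaled integer vectors. [folklore] -/
theorem dist_scaled (N : ℕ) (w w' : Fin 3 → ℤ) :
    dist ((Real.sqrt N)⁻¹ • intVec w : E3) ((Real.sqrt N)⁻¹ • intVec w') =
      (Real.sqrt N)⁻¹ * Real.sqrt (sqNormInt (w - w') : ℝ) := by
  rw [dist_eq_norm, ← smul_sub, intVec_sub, norm_smul, norm_inv, Real.norm_of_nonneg (Real.sqrt_nonneg _),
    norm_intVec]

/-- Generic form of `twoShell_labels`: a two-shell pattern `P = (A ∪ B)/√N` whose kissing part
`K = A/√N = L/√18` has unit vectors at mutual distances `1` or `≥ √2` covering all directions, and whose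
second shell `B/√N` has norm `√2`. [folklore] -/
theorem twoShell_labels_aux {P K : Finset E3} {L A B : Finset (Fin 3 → ℤ)} {N : ℕ} (hN : N ≠ 0)
    (hK : K = scaledPattern L 18) (hKP : K ⊆ P) (hPAB : P = scaledPattern (A ∪ B) N)
    (hKA : K = scaledPattern A N) (hB : ∀ w ∈ B, sqNormInt w = 2 * (N : ℤ))
    (hB1 : ∀ w ∈ B, ∃ w' ∈ A, sqNormInt (w - w') = (N : ℤ))
    (hKn : ∀ v ∈ K, ‖v‖ = 1)
    (hdist : ∀ p ∈ K, ∀ q ∈ K, p ≠ q → dist p q = 1 ∨ Real.sqrt 2 ≤ dist p q)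
    (hcov : ∀ u : E3, ∃ v ∈ K, ‖u‖ ≤ Real.sqrt 2 * inner ℝ u v) :
    (∀ t ∈ L, ((Real.sqrt 18)⁻¹ • intVec t : E3) ∈ P) ∧
    (∀ t ∈ L, ‖((Real.sqrt 18)⁻¹ • intVec t : E3)‖ = 1) ∧
    (∀ v ∈ P, (∃ t ∈ L, ((Real.sqrt 18)⁻¹ • intVec t : E3) = v) ∨ ‖v‖ = Real.sqrt 2) ∧
    (∀ t ∈ L, ∀ t' ∈ L, t ≠ t' →
      dist ((Real.sqrt 18)⁻¹ • intVec t : E3) ((Real.sqrt 18)⁻¹ • intVec t') = 1 ∨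
        Real.sqrt 2 ≤ dist ((Real.sqrt 18)⁻¹ • intVec t : E3) ((Real.sqrt 18)⁻¹ • intVec t')) ∧
    (∀ u : E3, ∃ t ∈ L, ‖u‖ ≤ Real.sqrt 2 * inner ℝ u ((Real.sqrt 18)⁻¹ • intVec t : E3)) ∧
    (∀ v ∈ P, ∃ t ∈ L, ((Real.sqrt 18)⁻¹ • intVec t : E3) = v ∨
      dist v ((Real.sqrt 18)⁻¹ • intVec t : E3) = 1) := by
  have hmemK : ∀ t ∈ L, ((Real.sqrt 18)⁻¹ • intVec t : E3) ∈ K := fun t ht => by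
    rw [hK, mem_scaledPattern_eighteen]
    exact ⟨t, ht, rfl⟩
  have hKL : ∀ w ∈ A, ∃ t ∈ L, ((Real.sqrt 18)⁻¹ • intVec t : E3) = (Real.sqrt N)⁻¹ • intVec w := by
    intro w hwA
    have : ((Real.sqrt N)⁻¹ • intVec w : E3) ∈ K := by
      rw [hKA, scaledPattern]
      exact Finset.mem_image_of_mem _ hwA
    rw [hK, mem_scaledPattern_eighteen] at this
    exact this
  refine ⟨fun t ht => hKP (hmemK t ht), fun t ht => hKn _ (hmemK t ht), ?_, ?_, ?_, ?_⟩
  · intro v hv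
    rw [hPAB, scaledPattern, Finset.mem_image] at hv
    obtain ⟨w, hw, rfl⟩ := hv
    rcases Finset.mem_union.1 hw with hwA | hwB
    · exact Or.inl (hKL w hwA)
    · right
      have hmem : ((Real.sqrt N)⁻¹ • intVec w : E3) ∈ scaledPattern B N := by
        rw [scaledPattern]
        exact Finset.mem_image_of_mem _ hwB
      obtain ⟨w', hw', h⟩ := norm_of_mem_scaledPattern hN hmem
      show ‖((Real.sqrt N)⁻¹ • intVec w : E3)‖ = Real.sqrt 2
      rw [h, hB w' hw']
      congr 1
      have hN' : (N : ℝ) ≠ 0 := by exact_mod_cast hN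
      push_cast
      rw [mul_div_assoc, div_self hN', mul_one]
  · intro t ht t' htt hne
    exact hdist _ (hmemK t ht) _ (hmemK t' htt) (fun h => hne (scale18_injective h))
  · intro u
    obtain ⟨v, hv, h⟩ := hcov u
    rw [hK, mem_scaledPattern_eighteen] at hv
    obtain ⟨t, ht, rfl⟩ := hv
    exact ⟨t, ht, h⟩
  · intro v hv
    rw [hPAB, scaledPattern, Finset.mem_image] at hv
    obtain ⟨w, hw, rfl⟩ := hv
    rcases Finset.mem_union.1 hw with hwA | hwB
    · obtain ⟨t, ht, h⟩ := hKL w hwA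
      exact ⟨t, ht, Or.inl h⟩
    · obtain ⟨w', hw'A, hww'⟩ := hB1 w hwB
      obtain ⟨t, ht, h⟩ := hKL w' hw'A
      refine ⟨t, ht, Or.inr ?_⟩
      show dist ((Real.sqrt N)⁻¹ • intVec w : E3) ((Real.sqrt 18)⁻¹ • intVec t : E3) = 1
      rw [h, dist_scaled, hww']
      push_cast
      have hN' : (0 : ℝ) < Real.sqrt N := Real.sqrt_pos.2 (by exact_mod_cast Nat.pos_of_ne_zero hN)
      exact inv_mul_cancel₀ hN'.ne'

/-- **The kissing part of a two-shell pattern as integer labels at scale `1/√18`.**  For either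
two-shell pattern `P` there is `L ∈ {fcc3Int, hcpInt}` with: `L/√18 ⊆ P` consists of unit vectors, every
other point of `P` has norm `√2`, distinct points of `L/√18` are at distance `1` or `≥ √2`, and every
direction `u` has a point of `L/√18` at cosine `≥ 1/√2`. [cite: ConwaySloane1999, Ch. 4 §6.3] -/
theorem twoShell_labels {P : Finset E3} (hP : P = fccTwoShellPattern ∨ P = hcpTwoShellPattern) :
    ∃ L : Finset (Fin 3 → ℤ), (L = fcc3Int ∨ L = hcpInt) ∧
      (∀ t ∈ L, ((Real.sqrt 18)⁻¹ • intVec t : E3) ∈ P) ∧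
      (∀ t ∈ L, ‖((Real.sqrt 18)⁻¹ • intVec t : E3)‖ = 1) ∧
      (∀ v ∈ P, (∃ t ∈ L, ((Real.sqrt 18)⁻¹ • intVec t : E3) = v) ∨ ‖v‖ = Real.sqrt 2) ∧
      (∀ t ∈ L, ∀ t' ∈ L, t ≠ t' →
        dist ((Real.sqrt 18)⁻¹ • intVec t : E3) ((Real.sqrt 18)⁻¹ • intVec t') = 1 ∨
          Real.sqrt 2 ≤ dist ((Real.sqrt 18)⁻¹ • intVec t : E3) ((Real.sqrt 18)⁻¹ • intVec t')) ∧
      (∀ u : E3, ∃ t ∈ L, ‖u‖ ≤ Real.sqrt 2 * inner ℝ u ((Real.sqrt 18)⁻¹ • intVec t : E3)) ∧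
      (∀ v ∈ P, ∃ t ∈ L, ((Real.sqrt 18)⁻¹ • intVec t : E3) = v ∨
        dist v ((Real.sqrt 18)⁻¹ • intVec t : E3) = 1) := by
  have hfcc1 : ∀ w ∈ fccSecondShellInt, ∃ w' ∈ fccInt, sqNormInt (w - w') = ((2 : ℕ) : ℤ) := by decide
  have hhcp1 : ∀ w ∈ hcpSecondShellInt, ∃ w' ∈ hcpInt, sqNormInt (w - w') = ((18 : ℕ) : ℤ) := by decide
  have hfcc4 : ∀ w ∈ fccSecondShellInt, sqNormInt w = 2 * ((2 : ℕ) : ℤ) := by decide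
  have hhcp36 : ∀ w ∈ hcpSecondShellInt, sqNormInt w = 2 * ((18 : ℕ) : ℤ) := by decide
  rcases hP with rfl | rfl
  · exact ⟨fcc3Int, Or.inl rfl, twoShell_labels_aux (A := fccInt) (B := fccSecondShellInt) (N := 2) two_ne_zero
      fccKissingPattern_eq_scaledPattern_fcc3Int
      fccKissingPattern_subset rfl rfl hfcc4 hfcc1 (fun v hv => norm_eq_one_of_mem_fccKissingPattern hv)
      (fun p hp q hq hpq => dist_eq_one_or_sqrt_two_le_of_mem_fccKissingPattern hp hq hpq) fcc_coveringAngle⟩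
  · exact ⟨hcpInt, Or.inr rfl, twoShell_labels_aux (A := hcpInt) (B := hcpSecondShellInt) (N := 18) (by norm_num)
      hcpKissingPattern_eq_scaledPattern_hcpInt
      hcpKissingPattern_subset rfl rfl hhcp36 hhcp1 (fun v hv => norm_eq_one_of_mem_hcpKissingPattern hv)
      (fun p hp q hq hpq => dist_eq_one_or_sqrt_two_le_of_mem_hcpKissingPattern hp hq hpq) hcp_coveringAngle⟩

/-! ## §3 Metric consequences of an `ε·a`-match -/

section Match

variable {a : ℝ} {A : E3 →ₗᵢ[ℝ] E3} {x : E3}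

/-- `dist (x, x + a·A v) = a‖v‖`. [folklore] -/
theorem dist_center_ideal (ha : 0 ≤ a) (v : E3) : dist x (x + a • A v) = a * ‖v‖ := by
  rw [dist_comm, dist_eq_norm, add_sub_cancel_left, norm_smul, Real.norm_of_nonneg ha, A.norm_map]

/-- `dist (x + a·A v, x + a·A w) = a·dist (v, w)`. [folklore] -/
theorem dist_ideal_ideal (ha : 0 ≤ a) (v w : E3) : dist (x + a • A v) (x + a • A w) = a * dist v w := by
  rw [dist_eq_norm, add_sub_add_left_eq_sub, ← smul_sub, ← map_sub, norm_smul, Real.norm_of_nonneg ha,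
    A.norm_map, dist_eq_norm]

/-- Distance to a matched point: `|dist (x, p) − a‖v‖| ≤` the matching error. [folklore] -/
theorem dist_center_bounds (ha : 0 ≤ a) {p : E3} {v : E3} {e : ℝ} (hp : dist p (x + a • A v) ≤ e) :
    a * ‖v‖ - e ≤ dist x p ∧ dist x p ≤ a * ‖v‖ + e := by
  have h1 := dist_triangle x (x + a • A v) p
  have h2 := dist_triangle x p (x + a • A v)
  rw [dist_center_ideal ha] at h1 h2
  rw [dist_comm] at hp
  constructor <;> linarith [dist_comm p (x + a • A v)]

/-- Distance of two matched points: `|dist (p, q) − a·dist (v, w)| ≤` twice the matching error. [folklore] -/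
theorem dist_pair_bounds (ha : 0 ≤ a) {p q v w : E3} {e : ℝ} (hp : dist p (x + a • A v) ≤ e)
    (hq : dist q (x + a • A w) ≤ e) :
    a * dist v w - 2 * e ≤ dist p q ∧ dist p q ≤ a * dist v w + 2 * e := by
  have h1 := dist_triangle p (x + a • A v) q
  have h2 := dist_triangle (x + a • A v) (x + a • A w) q
  have h3 := dist_triangle (x + a • A v) p q
  have h4 := dist_triangle (x + a • A v) q (x + a • A w)
  rw [dist_ideal_ideal ha] at h2 h4
  rw [dist_comm] at hq
  have h5 : dist (x + a • A v) p ≤ e := by rwa [dist_comm]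
  constructor <;> linarith [dist_comm q (x + a • A w)]

end Match

/-! ## §4 The integer chart at a good site -/

/-- **The empty annulus.**  In an all-good set two distinct points at distance `≤ 6/5` are bonded
(distance `≤ 28/25`): read off the two-shell pattern of either point, a neighbour within `3a/2` is a
first-shell image (distance `≤ 17a/16 ≤ 1.0944`) or a second-shell image (distance `≥ (√2 − 1/16)a > 6/5`).
[cite: HalesDSP2012, §1.3] -/
theorem annulus {Y : Set E3} (hY : ∀ q ∈ Y, IsTwoShellGoodSet (1 / 16) (9 / 10) (103 / 100) Y q)
    {p q : E3} (hp : p ∈ Y) (hq : q ∈ Y) (hpq : p ≠ q) (hd : dist p q ≤ 6 / 5) : dist p q ≤ 28 / 25 := by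
  obtain ⟨a, ha9, ha1, A, P, f, hP, hf, -, hsurj⟩ := hY p hp
  have ha0 : 0 ≤ a := by linarith
  have ha2 : 9 / 10 * (14142 / 10000) ≤ a * Real.sqrt 2 := mul_le_mul ha9 sqrt_two_bounds.1.le (by norm_num) ha0
  obtain ⟨u, hu, hfu⟩ := hsurj q hq hpq.symm (by rw [dist_comm]; linarith)
  have hb := dist_center_bounds ha0 (hf u hu).2
  rw [hfu] at hb
  obtain ⟨L, -, -, hLn, hPL, -⟩ := twoShell_labels hP
  rcases hPL u hu with ⟨s, hs, hsu⟩ | hn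
  · have hn1 : ‖u‖ = 1 := by rw [← hsu]; exact hLn s hs
    rw [hn1] at hb
    linarith [hb.2]
  · rw [hn] at hb
    linarith [hb.1]

/-- **Two steps reach the `27/20`-ball.**  In an all-good set, a point `z ≠ x` within `27/20 ≤ 3a/2` of `x`
is bonded to `x` (first shell) or to a first-shell neighbour of `x` (second shell: every second-shell
vector of either pattern is at distance `1` from a kissing vector, and the two images are then within
`9a/8 ≤ 6/5`, hence bonded by `annulus`). [cite: HalesDSP2012, §1.3] -/
theorem two_step {Y : Set E3} (hY : ∀ q ∈ Y, IsTwoShellGoodSet (1 / 16) (9 / 10) (103 / 100) Y q)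
    {x z : E3} (hx : x ∈ Y) (hz : z ∈ Y) (hxz : x ≠ z) (hd : dist x z ≤ 27 / 20) :
    (0 < dist x z ∧ dist x z ≤ 28 / 25) ∨
      ∃ y ∈ Y, (0 < dist x y ∧ dist x y ≤ 28 / 25) ∧ (0 < dist y z ∧ dist y z ≤ 28 / 25) := by
  obtain ⟨a, ha9, ha1, A, P, f, hP, hf, hinj, hsurj⟩ := hY x hx
  have ha0 : 0 ≤ a := by linarith
  obtain ⟨L, -, hLP, hLn, -, -, -, hL1⟩ := twoShell_labels hP
  obtain ⟨v, hv, rfl⟩ := hsurj z hz hxz.symm (by rw [dist_comm]; linarith)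
  obtain ⟨t, ht, h⟩ := hL1 v hv
  have hbt : 0 < dist x (f ((Real.sqrt 18)⁻¹ • intVec t)) ∧ dist x (f ((Real.sqrt 18)⁻¹ • intVec t)) ≤ 28 / 25 := by
    have hb := dist_center_bounds ha0 (hf _ (hLP t ht)).2
    rw [hLn t ht] at hb
    constructor <;> linarith [hb.1, hb.2]
  rcases h with hv' | hd1
  · left
    rw [← hv']
    exact hbt
  · right
    refine ⟨f ((Real.sqrt 18)⁻¹ • intVec t), (hf _ (hLP t ht)).1, hbt, ?_⟩
    have hne : f ((Real.sqrt 18)⁻¹ • intVec t) ≠ f v := fun h => by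
      have h' : ((Real.sqrt 18)⁻¹ • intVec t : E3) = v := hinj (hLP t ht) hv h
      rw [h', dist_self] at hd1
      exact zero_ne_one hd1
    have hpb := dist_pair_bounds ha0 (hf _ (hLP t ht)).2 (hf v hv).2
    rw [dist_comm ((Real.sqrt 18)⁻¹ • intVec t : E3) v, hd1] at hpb
    exact ⟨dist_pos.2 hne, annulus hY (hf _ (hLP t ht)).1 (hf v hv).1 hne (by linarith [hpb.2])⟩

/-- **Integer chart at a site of an all-good set.**  If every point of `Y` is
`(1/16, 9/10, 103/100)`-two-shell-good, then at each `x ∈ Y` there are labels `L ∈ {fcc3Int, hcpInt}` and a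
labelling `nb` of the `(0, 28/25]`-bonded neighbours of `x`, bijective on `L`, each `nb t` within `b/5` of
`x + b·A(t/√18)` for some linear isometry `A` at the common scale `b = 193/200`, with exact links
(`nb t ~ nb t'` iff `|t − t'|² = 18`), and for every direction `d` a label `t` with
`⟪nb t − x, d⟫ ≥ (139/250)‖d‖`. [cite: HalesDSP2012, §1.3; ConwaySloane1999, Ch. 4 §6.3] -/
theorem intChart {Y : Set E3} (hY : ∀ q ∈ Y, IsTwoShellGoodSet (1 / 16) (9 / 10) (103 / 100) Y q)
    {x : E3} (hx : x ∈ Y) :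
    ∃ (L : Finset (Fin 3 → ℤ)) (nb : (Fin 3 → ℤ) → E3), (L = fcc3Int ∨ L = hcpInt) ∧
      Set.BijOn nb ↑L {y | y ∈ Y ∧ (0 < dist x y ∧ dist x y ≤ 28 / 25)} ∧
      (∃ A : E3 →ₗᵢ[ℝ] E3, ∀ t ∈ L,
        dist (nb t) (x + ((193 / 200 : ℝ) * (Real.sqrt 18)⁻¹) • A (intVec t)) ≤ (193 / 200 : ℝ) / 5) ∧
      (∀ t ∈ L, ∀ t' ∈ L, ((0 < dist (nb t) (nb t') ∧ dist (nb t) (nb t') ≤ 28 / 25) ↔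
        sqNormInt (t - t') = 18)) ∧
      (∀ d : E3, ∃ t ∈ L, (139 : ℝ) / 250 * ‖d‖ ≤ inner ℝ (nb t - x) d) := by
  obtain ⟨a, ha9, ha1, A, P, f, hP, hf, hinj, hsurj⟩ := hY x hx
  obtain ⟨L, hL, hLP, hLn, hPL, hLd, hcov, -⟩ := twoShell_labels hP
  have ha0 : 0 ≤ a := by linarith
  have hs2 := sqrt_two_bounds
  have ha2 : 9 / 10 * (14142 / 10000) ≤ a * Real.sqrt 2 := mul_le_mul ha9 hs2.1.le (by norm_num) ha0
  -- distances from the centre: first shell bonded, second shell beyond `6/5`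
  have hnear : ∀ t ∈ L, 0 < dist x (f ((Real.sqrt 18)⁻¹ • intVec t)) ∧ dist x (f ((Real.sqrt 18)⁻¹ • intVec t)) ≤ 28 / 25 := by
    intro t ht
    have hb := dist_center_bounds ha0 (hf _ (hLP t ht)).2
    rw [hLn t ht] at hb
    constructor <;> linarith [hb.1, hb.2]
  have hfar : ∀ v ∈ P, ‖v‖ = Real.sqrt 2 → 6 / 5 < dist x (f v) := by
    intro v hv hn
    have hb := (dist_center_bounds ha0 (hf v hv).2).1
    rw [hn] at hb
    linarith
  refine ⟨L, fun t => f ((Real.sqrt 18)⁻¹ • intVec t), hL, ⟨?_, ?_, ?_⟩, ⟨A, ?_⟩, ?_, ?_⟩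
  · -- maps into the bonded neighbours
    intro t ht
    exact ⟨(hf _ (hLP t ht)).1, hnear t ht⟩
  · -- injective
    intro t ht t' ht' h
    exact scale18_injective (hinj (hLP t ht) (hLP t' ht') h)
  · -- onto the bonded neighbours
    rintro y ⟨hy, hpos, hle⟩
    have hyx : y ≠ x := fun h => by rw [h, dist_self] at hpos; exact lt_irrefl _ hpos
    obtain ⟨v, hv, rfl⟩ := hsurj y hy hyx (by rw [dist_comm]; linarith)
    rcases hPL v hv with ⟨t, ht, htv⟩ | hn
    · exact ⟨t, ht, by show f ((Real.sqrt 18)⁻¹ • intVec t) = f v; rw [htv]⟩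
    · exact absurd hle (not_le.2 (by linarith [hfar v hv hn]))
  · -- closeness at the common scale `b = 193/200`
    intro t ht
    have e : x + ((193 / 200 : ℝ) * (Real.sqrt 18)⁻¹) • A (intVec t) = x + (193 / 200 : ℝ) • A ((Real.sqrt 18)⁻¹ • intVec t) := by
      simp only [map_smul, smul_smul]
    rw [e]
    have h1 := (hf _ (hLP t ht)).2
    have h2 : dist (x + a • A ((Real.sqrt 18)⁻¹ • intVec t)) (x + (193 / 200 : ℝ) • A ((Real.sqrt 18)⁻¹ • intVec t)) = |a - 193 / 200| := by
      rw [dist_eq_norm, add_sub_add_left_eq_sub, ← sub_smul, norm_smul, Real.norm_eq_abs, A.norm_map,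
        hLn t ht, mul_one]
    have h3 := dist_triangle (f ((Real.sqrt 18)⁻¹ • intVec t)) (x + a • A ((Real.sqrt 18)⁻¹ • intVec t)) (x + (193 / 200 : ℝ) • A ((Real.sqrt 18)⁻¹ • intVec t))
    rw [h2] at h3
    rcases le_total a (193 / 200) with hab | hab
    · rw [abs_of_nonpos (by linarith)] at h3
      show dist (f ((Real.sqrt 18)⁻¹ • intVec t)) (x + (193 / 200 : ℝ) • A ((Real.sqrt 18)⁻¹ • intVec t)) ≤ 193 / 200 / 5
      linarith
    · rw [abs_of_nonneg (by linarith)] at h3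
      show dist (f ((Real.sqrt 18)⁻¹ • intVec t)) (x + (193 / 200 : ℝ) • A ((Real.sqrt 18)⁻¹ • intVec t)) ≤ 193 / 200 / 5
      linarith
  · -- exact links
    intro t ht t' ht'
    have hpb := dist_pair_bounds ha0 (hf _ (hLP t ht)).2 (hf _ (hLP t' ht')).2
    constructor
    · rintro ⟨hpos, hle⟩
      have hne : t ≠ t' := by
        rintro rfl
        rw [dist_self] at hpos
        exact lt_irrefl _ hpos
      rcases hLd t ht t' ht' hne with h1 | h1
      · exact (dist_scale18_eq_one_iff t t').1 h1
      · exfalso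
        have : a * Real.sqrt 2 ≤ a * dist ((Real.sqrt 18)⁻¹ • intVec t : E3) ((Real.sqrt 18)⁻¹ • intVec t') := mul_le_mul_of_nonneg_left h1 ha0
        have h' : dist (f ((Real.sqrt 18)⁻¹ • intVec t)) (f ((Real.sqrt 18)⁻¹ • intVec t')) ≤ 28 / 25 := hle
        linarith [hpb.1]
    · intro h18
      have h1 : dist ((Real.sqrt 18)⁻¹ • intVec t : E3) ((Real.sqrt 18)⁻¹ • intVec t') = 1 := (dist_scale18_eq_one_iff t t').2 h18
      have hne : ((Real.sqrt 18)⁻¹ • intVec t : E3) ≠ (Real.sqrt 18)⁻¹ • intVec t' := fun h => by rw [h, dist_self] at h1; exact zero_ne_one h1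
      have hfne : f ((Real.sqrt 18)⁻¹ • intVec t) ≠ f ((Real.sqrt 18)⁻¹ • intVec t') := fun h => hne (hinj (hLP t ht) (hLP t' ht') h)
      refine ⟨dist_pos.2 hfne, ?_⟩
      have hup : dist (f ((Real.sqrt 18)⁻¹ • intVec t)) (f ((Real.sqrt 18)⁻¹ • intVec t')) ≤ 1159 / 1000 := by
        rw [h1] at hpb
        linarith [hpb.2]
      -- the upper bound `≤ 28/25` is read off the NEIGHBOUR's own two-shell pattern (`annulus`)
      exact annulus hY (hf _ (hLP t ht)).1 (hf _ (hLP t' ht')).1 hfne (by linarith)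
  · -- a bonded neighbour in every direction
    intro d
    obtain ⟨u, hu⟩ : ∃ u : E3, A u = d := by
      obtain ⟨u, hu⟩ := (A.toLinearIsometryEquiv rfl).surjective d
      exact ⟨u, by simpa using hu⟩
    obtain ⟨t, ht, hcos⟩ := hcov u
    refine ⟨t, ht, ?_⟩
    have hvY := hf _ (hLP t ht)
    have hsplit : inner ℝ (f ((Real.sqrt 18)⁻¹ • intVec t) - x) d =
        a * inner ℝ u ((Real.sqrt 18)⁻¹ • intVec t : E3) + inner ℝ (f ((Real.sqrt 18)⁻¹ • intVec t) - (x + a • A ((Real.sqrt 18)⁻¹ • intVec t))) d := by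
      rw [← hu, show f ((Real.sqrt 18)⁻¹ • intVec t) - x = a • A ((Real.sqrt 18)⁻¹ • intVec t) + (f ((Real.sqrt 18)⁻¹ • intVec t) - (x + a • A ((Real.sqrt 18)⁻¹ • intVec t))) by abel, inner_add_left,
        real_inner_smul_left, A.inner_map_map, real_inner_comm u ((Real.sqrt 18)⁻¹ • intVec t : E3)]
    have herr : |inner ℝ (f ((Real.sqrt 18)⁻¹ • intVec t) - (x + a • A ((Real.sqrt 18)⁻¹ • intVec t))) d| ≤ 1 / 16 * a * ‖d‖ := by
      refine (abs_real_inner_le_norm _ _).trans ?_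
      rw [← dist_eq_norm]
      exact mul_le_mul_of_nonneg_right hvY.2 (norm_nonneg _)
    have hnu : ‖u‖ = ‖d‖ := by rw [← hu, A.norm_map]
    rw [hnu] at hcos
    have hd0 : 0 ≤ ‖d‖ := norm_nonneg _
    have hI0 : 0 ≤ inner ℝ u ((Real.sqrt 18)⁻¹ • intVec t : E3) := by
      by_contra h
      have : Real.sqrt 2 * inner ℝ u ((Real.sqrt 18)⁻¹ • intVec t : E3) < 0 :=
        mul_neg_of_pos_of_neg (by linarith [hs2.1]) (not_le.1 h)
      linarith
    have hI : ‖d‖ ≤ 14143 / 10000 * inner ℝ u ((Real.sqrt 18)⁻¹ • intVec t : E3) :=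
      hcos.trans (mul_le_mul_of_nonneg_right hs2.2.le hI0)
    have haI : 9 / 10 * inner ℝ u ((Real.sqrt 18)⁻¹ • intVec t : E3) ≤ a * inner ℝ u ((Real.sqrt 18)⁻¹ • intVec t : E3) := mul_le_mul_of_nonneg_right ha9 hI0
    have han : a * ‖d‖ ≤ 103 / 100 * ‖d‖ := mul_le_mul_of_nonneg_right ha1 hd0
    have hlo := (abs_le.1 herr).1
    show (139 : ℝ) / 250 * ‖d‖ ≤ inner ℝ (f ((Real.sqrt 18)⁻¹ • intVec t) - x) d
    rw [hsplit]
    linarith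

end Summit.AtomisticToContinuum.Crystallization.Theorems.ChartedPlanarOrderBarlowGluingCharts
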